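import Literature.MathematicalPhysics.QuantumFieldTheory.Balaban1983to89.B9Cor35PDirWordIdentity
import Literature.MathematicalPhysics.QuantumFieldTheory.Balaban1983to89.B9Eq376ProjPieceDictY
import Literature.MathematicalPhysics.QuantumFieldTheory.Balaban1983to89.B9Cor35GDirAtCubeLetters

/-!
# `Balaban1983to89.B9Eq376ProjPieceDirDictY` — [Balaban1985BackgroundPropagators] (3.76)–(3.77) pp. 405–406 AT PRINT's DIRICHLET PROJECTION LETTER, IN
# node00-def-Y's BOND-SECTOR LETTERS: the `hPP` binder of the Dirichlet bond `G`-step (`B9Cor35GDirAtCubeLetters.cor35_GDir_of_pieces`) PRODUCED — r05's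
# dictionary `B9Eq376ProjPieceDictY` (r06's `gradLin ∕ divLin` on `(Fin(d+1) × SiteY) × ι` ↔ def-Y's `gradY ∕ divY` on `FBondY × ι`, same kernel) applied to FILE
# `B9Cor35PDirWordIdentity.cor35_PCubeDY_cube`, and the Dirichlet projection piece `projPieceDirK` SPLIT as first-order part + `P₁` word
# (ROAD (I) U6e; seat dag-n06-c g33)

statement-level skeleton of published theorems with citation tags; proofs where landed; nothing here is a claim about the Yang–Mills mass gap

## What this file does (mathematically)

[Balaban1985BackgroundPropagators] (3.76) p. 405 with `R = I − P` ((3.25) p. 394) splits the projection piece of (3.82) p. 407,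
`D₁R_□(1)D₁* − D_ṼR_□(Ṽ)D*_Ṽ = (D₁D₁* − D_ṼD*_Ṽ) + (D_Ṽ𝒫_□(Ṽ)D*_Ṽ − D₁𝒫_□(1)D*₁)`, the first bracket being first order in `A` (r05's `conj_gradDiv_one_sub_gradDiv_eq`)
and the second the `P₁` word estimated by (3.77).  At the cube sequence's Dirichlet letters (p. 409 l. 1–5) `𝒫_□ = PCubeDY i □ 𝔭 (GpDirY … Ω₀(□)) 𝔖`:
* §1 ★★ `projPieceDirK_eq_firstOrder_add_projWord` — the split of FILE `B9Cor35GDirAtCubeLetters.projPieceDirK` (def-Y's `DPDsDirCubeY = D_U 𝒫_□(U) D*_U`);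
* §2 ★★ `hasMajorant_projWordDir_of_PDir` — r05's carrier dictionary `hasMajorant_conj_gradMdiv_sub_of_relabel` at `M = 𝒫_□(Ṽ)`, `M₁ = 𝒫_□(1)`;
* §3 ★★★ `hPP_dirC_cube` — (3.77) for `conj b((D_Ṽ𝒫_□(Ṽ)D*_Ṽ − D₁𝒫_□(1)D₁*)^ℝ)` over `(toB6 (geoCK i □) Rr H, blkBK i □)` at the small field of a cut potential, uniformly in
  the member and the cover cube: the `hPP` binder of `cor35_GDir_of_pieces` at `S = Ω₀(□)`.

## Status

Printed-statement pass + proof body (proof-backed; a port in the tree's vocabulary; assembly): [Balaban1985BackgroundPropagators] pp. 394, 405–409, re-read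
2026-08-31.  Honest label: bookkeeping composition of landed results; the `A`-dependent (3.37)∕(3.59) data stay hypotheses.  Node N06 of the `pub-ymgap` DAG is
NOT discharged here and the Yang–Mills mass gap is NOT proved here.  NEW file; nothing landed is modified.  No `sorry`, no `axiom`, no `instance`, no
`notation`.  Net new unproved facts: 0.  Cell `pub-ymgap` (HUMAN RULING D-0062), node N06 [B9], seat `pub-ymgap-dag-n06-c` (g33), 2026-08-31.
RELATED, NOT DUPLICATED (searched 2026-08-31: `rg 'projPieceDirK_eq_firstOrder_add_projWord|hasMajorant_projWordDir_of_PDir|hPP_dirC_cube'` = ∅): r05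
`B9Eq376ProjPieceDictY` (the torus letter; its generic lemmas USED BY NAME).
-/

noncomputable section

namespace Literature.MathematicalPhysics.QuantumFieldTheory.Balaban1983to89.B9Eq376ProjPieceDirDictY

open B6KLevelCensusIndexV1 (KIdx kGeo)
open B6Cover236MultiLevelBlocks (cubes)
open B6RandomWalk (HasMajorant)
open B9Thm34Ext (toB6)
open B9Eq352DivFormLetters (conj)
open B9Eq376POneLetters (conjHom gradLin divLin)
open B9Eq39Adjoint (covD covDstar)
open B9Eq352DivForm (tauB)
open B9CubeLettersOpsL0 (cubeFamY oddMh)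
open B9CubeLettersBondOpsL0 (BlkCubeY qpKc qpsKc QpCubeY QpsCubeY)
open B9Eq360DeltaPrimeAY (AfldY chartA)
open B9Eq360DeltaPrimeACubeY (blkCubeY kFCubeY sFCubeY)
open B9CubeGeometryInputs (geoCK RM1)
open B9Cor35GpCubeInputsAtOne (wK)
open B9Cor35GCubeInputsAtOne (blkBK DK)
open B9Eq375GradDivSplitY (P0Y P1Y conj_gradDiv_one_sub_gradDiv_eq)
open B9Eq376ProjPieceDictY (hasMajorant_conj_gradMdiv_sub_of_relabel inv_eta_coe_eq)
open B9Cor35GpDirInputsAtOne (dirDomY)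
open B9Eq337CutFieldDirY (cutFldS cutCfgS)
open B9Cor35CDirCarrierAtOne (SBlk)
open B9Cor35PDirWordIdentity (cor35_PCubeDY_cube)
open B9Cor35GDirAtCubeLetters (projPieceDirK)
open Node00 (SiteY CfgY toKT shiftY UboxY gradY divY)
open Node00.OpsYCubeDirInverse (GpDirY)
open Node00.OpsYCubeKnitPar (parKnitCubeY)
open Node00.OpsYCubeProjectionG (insideBlkY PCubeDY DPDsCubeDY_eq_gradY_PCubeDY_divY)

variable {d ℓ : ℕ} {hd : 1 ≤ d + 1} {hL : Odd (ℓ + 1) ∧ 1 < ℓ + 1} {b₀ b₁ : ℝ}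
variable {𝔸 : Type} [NormedRing 𝔸] [NormedAlgebra ℂ 𝔸] [CompleteSpace 𝔸]
variable {ι : Type} [Fintype ι] (b : Module.Basis ι ℝ 𝔸)

/-! ## §1 The Dirichlet projection piece splits: first-order part + `P₁` word -/

section Split

variable (i : KIdx d ℓ hd hL b₀ b₁) (q : ↥(cubes (toKT i).D.toDomains)) (S : Finset (SiteY i))

/-- ★★ **`projPieceDirK b i □ S Ṽ = conj b(P0Y Ṽ^ℝ) + Σ_ν conj b(P1Y Ṽ ν^ℝ)·DK b i ν + conj b((D_Ṽ𝒫_□(Ṽ)D*_Ṽ − D₁𝒫_□(1)D*₁)^ℝ)`**, `𝒫_□ = PCubeDY i □ 𝔭 (GpDirY … S) 𝔖`.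
[cite: Balaban1985BackgroundPropagators, (3.74)–(3.76) p.405, (3.25) p.394, (3.82) p.407, p.409 l.1–5] -/
theorem projPieceDirK_eq_firstOrder_add_projWord (V : CfgY 𝔸 i) :
    projPieceDirK b i q S V =
      conj b ((P0Y i V).restrictScalars ℝ) + ∑ ν, conj b ((P1Y i V ν).restrictScalars ℝ) * DK b i ν +
        conj b ((gradY i V ∘ₗ PCubeDY i q (parKnitCubeY i q) (GpDirY i q (parKnitCubeY i q) S) (insideBlkY i q S) V ∘ₗ divY i V -
          gradY i (fun _ _ => 1) ∘ₗ PCubeDY i q (parKnitCubeY i q) (GpDirY i q (parKnitCubeY i q) S) (insideBlkY i q S) (fun _ _ => 1) ∘ₗ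
            divY i (fun _ _ => 1)).restrictScalars ℝ) := by
  rw [← conj_gradDiv_one_sub_gradDiv_eq, projPieceDirK]
  dsimp only [Node00.OpsYCubeProjectionG.DPDsDirCubeY]
  rw [DPDsCubeDY_eq_gradY_PCubeDY_divY, DPDsCubeDY_eq_gradY_PCubeDY_divY, ← B9Cor36GpCubeEntriesAtV.conj_add']
  congr 1
  refine LinearMap.ext fun X => ?_
  simp only [LinearMap.restrictScalars_apply, LinearMap.add_apply, LinearMap.sub_apply, LinearMap.comp_apply]
  abel

end Split

/-! ## §2 r05's carrier dictionary at the Dirichlet projection letter -/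

section Dict

variable (i : KIdx d ℓ hd hL b₀ b₁) (c : ↥(cubes (toKT i).D.toDomains))

set_option maxRecDepth 16384 in
/-- ★★ **THE (3.77) MAJORANT TRANSPORTS TO def-Y's BOND CARRIER WITH THE SAME KERNEL** (r05's `hasMajorant_conj_gradMdiv_sub_of_relabel` at `M = 𝒫_□(Ṽ)`, `M₁ = 𝒫_□(1)`).
[cite: Balaban1985BackgroundPropagators, (3.76)–(3.77) pp.405–406; Balaban1984PropagatorsII, (2.51) p.232, dictionary] -/
theorem hasMajorant_projWordDir_of_PDir (Rr : ℝ) (H : Prop) (V : CfgY 𝔸 i) {K : BlkCubeY i c → BlkCubeY i c → ℝ}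
    (h : HasMajorant (g := toB6 (geoCK i c) Rr H) (fun q : (Fin (d + 1) × SiteY i) × ι => blkCubeY i c q.1.2)
      (conjHom b (gradLin (shiftY i) (((geoCK i c).eta : ℂ)⁻¹) (UboxY i V)) ∘ₗ
          conj b ((PCubeDY i c (parKnitCubeY i c) (GpDirY i c (parKnitCubeY i c) (dirDomY i c)) (SBlk i c) V).restrictScalars ℝ) ∘ₗ
          conjHom b (divLin (shiftY i) (((geoCK i c).eta : ℂ)⁻¹) (UboxY i V)) -
        conjHom b (gradLin (shiftY i) (((geoCK i c).eta : ℂ)⁻¹) (fun _ _ => (1 : 𝔸ˣ))) ∘ₗ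
          conj b ((PCubeDY i c (parKnitCubeY i c) (GpDirY i c (parKnitCubeY i c) (dirDomY i c)) (SBlk i c) (fun _ _ => 1)).restrictScalars ℝ) ∘ₗ
          conjHom b (divLin (shiftY i) (((geoCK i c).eta : ℂ)⁻¹) (fun _ _ => (1 : 𝔸ˣ)))) K) :
    HasMajorant (g := toB6 (geoCK i c) Rr H) (blkBK i c)
      (conj b ((gradY i V ∘ₗ PCubeDY i c (parKnitCubeY i c) (GpDirY i c (parKnitCubeY i c) (dirDomY i c)) (SBlk i c) V ∘ₗ divY i V -
        gradY i (fun _ _ => 1) ∘ₗ PCubeDY i c (parKnitCubeY i c) (GpDirY i c (parKnitCubeY i c) (dirDomY i c)) (SBlk i c) (fun _ _ => 1) ∘ₗ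
          divY i (fun _ _ => 1)).restrictScalars ℝ)) K := by
  obtain ⟨hη, hsq⟩ := inv_eta_coe_eq i c
  have hU : UboxY i (fun _ _ => (1 : 𝔸ˣ)) = fun _ _ => 1 := rfl
  rw [hη, ← hU] at h
  exact hasMajorant_conj_gradMdiv_sub_of_relabel b i (g := geoCK i c) (Rr := Rr) (H := H) (blkCubeY i c) V (fun _ _ => 1) _ _ hsq h

end Dict

/-! ## §3 ★★★ The `hPP` binder of the Dirichlet bond `G`-step, produced -/

set_option maxRecDepth 16384 in
/-- ★★★ **(3.77) FOR THE DIRICHLET PROJECTION PIECE IN def-Y's BOND LETTERS**: constants `δ > 0`, thresholds, `a₁ > 0`, `K ≥ 0` (functions of `d, L, M₂, C_q`) such that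
for every member above threshold, cover cube, `0 ≤ α₁ ≤ a₁` and vector potential `A` with the (3.37)∕(3.59) data of FILE `B9Cor35CDirAtCubeField` at the cut potential,
`conj b((D_Ṽ𝒫_□(Ṽ)D*_Ṽ − D₁𝒫_□(1)D*₁)^ℝ) ≺ K·α₁·ℓ(a)⁻²·e^{−δd}` over `(toB6 (geoCK i □) Rr H, blkBK i □)`, `Ṽ = cutCfgS Ω₀(□) η A` — the `hPP` binder of
`B9Cor35GDirAtCubeLetters.cor35_GDir_of_pieces` at `S = Ω₀(□)`. [cite: Balaban1985BackgroundPropagators, (3.76)–(3.77) pp.405–406, (3.82) p.407, Cor. 3.5 p.407, Cor. 3.6 p.408, p.409 l.1–5; Balaban1984PropagatorsII, Lemma 2.1 p.234, (2.51) p.232] -/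
theorem hPP_dirC_cube [DecidableEq ι] (d ℓ : ℕ) (hℓ : 1 ≤ ℓ) (Cq M₂ : ℝ) (hCq : 0 ≤ Cq) (hM₂ : 0 ≤ M₂) (hrepr : ∀ (v : 𝔸) (j : ι), |b.repr v j| ≤ M₂ * ‖v‖)
    (h1 : ‖(1 : 𝔸)‖ ≤ 1) :
    ∃ δ M₀ T₀ : ℝ, ∃ N₀ : ℕ, 0 < δ ∧ ∃ a₁ : ℝ, 0 < a₁ ∧ ∃ K : ℝ, 0 ≤ K ∧
    ∀ {hd : 1 ≤ d + 1} {hL : Odd (ℓ + 1) ∧ 1 < ℓ + 1} {b₀ b₁ : ℝ} (i : KIdx d ℓ hd hL b₀ b₁) (c : ↥(cubes (toKT i).D.toDomains)) (Rr : ℝ) (H : Prop),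
      M₀ ≤ ((ℓ : ℝ) + 1) * (toKT i).Mh → N₀ + 1 ≤ (toKT i).R * ((ℓ + 1) * (toKT i).Mh) → T₀ ≤ RM1 i →
    ∀ (α₁ : ℝ), 0 ≤ α₁ → α₁ ≤ a₁ →
    ∀ (A : AfldY 𝔸 i),
      (∀ y x, blkCubeY i c x = y →
        ‖kFCubeY i c (parKnitCubeY i c) (fun _ _ => 1) (cutCfgS i (dirDomY i c) (kGeo i).eta A) y x‖ ≤ Cq * α₁ * wK i c y) →
      (∀ x, ‖sFCubeY i c (parKnitCubeY i c) (fun _ _ => 1) (cutCfgS i (dirDomY i c) (kGeo i).eta A) x‖ ≤ Cq * α₁) →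
      (∀ ν k x, ‖(((geoCK i c).eta : ℂ)⁻¹) • covDstar (shiftY i) (fun _ _ => (1 : 𝔸ˣ)) ν (chartA i (cutFldS i (dirDomY i c) A) k) x‖ ≤
        α₁ * ((geoCK i c).len (blkCubeY i c x) ^ 2)⁻¹) →
      (∀ μ ν x, ‖(((geoCK i c).eta : ℂ)⁻¹) • covD (shiftY i) (fun _ _ => (1 : 𝔸ˣ)) μ (chartA i (cutFldS i (dirDomY i c) A) ν) x‖ ≤
        α₁ * ((geoCK i c).len (blkCubeY i c x) ^ 2)⁻¹) →
      (∀ μ x, ‖(((geoCK i c).eta : ℂ)⁻¹) • covDstar (shiftY i) (fun _ _ => (1 : 𝔸ˣ)) μ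
          (tauB (shiftY i) (fun _ _ => (1 : 𝔸ˣ)) μ (chartA i (cutFldS i (dirDomY i c) A) μ)) x‖ ≤ α₁ * ((geoCK i c).len (blkCubeY i c x) ^ 2)⁻¹) →
      (∀ k x, ‖chartA i (cutFldS i (dirDomY i c) A) k x‖ ≤ α₁ * ((geoCK i c).len (blkCubeY i c x))⁻¹) →
      (∀ ν k x, ‖tauB (shiftY i) (fun _ _ => (1 : 𝔸ˣ)) ν (chartA i (cutFldS i (dirDomY i c) A) k) x‖ ≤ α₁ * ((geoCK i c).len (blkCubeY i c x))⁻¹) →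
      (∀ z w : SiteY i, ‖(parKnitCubeY i c (cutCfgS i (dirDomY i c) (kGeo i).eta A) z w : 𝔸)‖ ≤ 1 ∧
        ‖(((parKnitCubeY i c (cutCfgS i (dirDomY i c) (kGeo i).eta A) z w)⁻¹ : 𝔸ˣ) : 𝔸)‖ ≤ 1) →
      (∀ (s : BlkCubeY i c) (lam : SiteY i → 𝔸),
        ‖(QpCubeY i c (parKnitCubeY i c) (cutCfgS i (dirDomY i c) (kGeo i).eta A) lam - QpCubeY i c (parKnitCubeY i c) (fun _ _ => 1) lam) s‖ ≤
          Cq * α₁ * ∑ z, |qpKc i c s z| * ‖lam z‖) →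
      (∀ (z : SiteY i) (nu : BlkCubeY i c → 𝔸),
        ‖(QpsCubeY i c (parKnitCubeY i c) (cutCfgS i (dirDomY i c) (kGeo i).eta A) nu - QpsCubeY i c (parKnitCubeY i c) (fun _ _ => 1) nu) z‖ ≤
          Cq * α₁ * ∑ s, |qpsKc i c z s| * ‖nu s‖) →
      HasMajorant (g := toB6 (geoCK i c) Rr H) (blkBK i c)
        (conj b ((gradY i (cutCfgS i (dirDomY i c) (kGeo i).eta A) ∘ₗ
            PCubeDY i c (parKnitCubeY i c) (GpDirY i c (parKnitCubeY i c) (dirDomY i c)) (SBlk i c) (cutCfgS i (dirDomY i c) (kGeo i).eta A) ∘ₗ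
            divY i (cutCfgS i (dirDomY i c) (kGeo i).eta A) -
          gradY i (fun _ _ => 1) ∘ₗ PCubeDY i c (parKnitCubeY i c) (GpDirY i c (parKnitCubeY i c) (dirDomY i c)) (SBlk i c) (fun _ _ => 1) ∘ₗ
            divY i (fun _ _ => 1)).restrictScalars ℝ))
        (fun a a' => K * α₁ * ((geoCK i c).len a ^ 2)⁻¹ * Real.exp (-(δ * (geoCK i c).dist a a'))) := by
  obtain ⟨δ, M₀, T₀, N₀, hδ, a₁, ha₁, K, hK, hP⟩ := cor35_PCubeDY_cube b d ℓ hℓ Cq M₂ hCq hM₂ hrepr h1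
  refine ⟨δ, M₀, T₀, N₀, hδ, a₁, ha₁, K, hK, ?_⟩
  intro hd hL b₀ b₁ i c Rr H hM hN hT α₁ hα0 hα1 A hkF hsF h337B h337F h337Bτ hA hAτB hparV hF hFs
  exact hasMajorant_projWordDir_of_PDir b i c Rr H _
    (hP i c Rr H hM hN hT α₁ hα0 hα1 A hkF hsF h337B h337F h337Bτ hA hAτB hparV hF hFs)

end Literature.MathematicalPhysics.QuantumFieldTheory.Balaban1983to89.B9Eq376ProjPieceDirDictY
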